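import Summits.AtomisticToContinuum.Crystallization.Theorems.PalmUnimodularRigidityLayeredLawsSelectHcpSelectionDefs

/-!
# Hägg selection (stub `stub_haggSelection` of line `mtp-prestress-split-ergodic-frame`, crux
# `LayeredLawsSelectHcp`, stmt-AtomisticToContinuum-9226), potential-free back end, I:
# the site type of a Barlow-like configuration is its local Hägg pattern; all-hexagonal words are hcp

The SELECTION half of the crux ("a minimising point-stationary layered law is a.s. hcp-charted")
factors as `P(root cubic) = 0` (energetic: sign and domination of the interlayer couplings, route item
stmt-AtomisticToContinuum-3063) followed by the potential-free implication
"`P cubicRoot = 0` ⇒ `HcpLayered P`" (`stub_haggSelection_nullCubicRoot`, part II). This file is the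
COMBINATORIAL core of the latter, over the vocabulary of the Defs addendum `…SelectionDefs`
(`Bond`, `IsHexSite`, the finite shell model `relLabel` / `ShellAdj` / `shellOffsets`):

* `shellModel_cubic` — in the shell model with equal adjacent letters (cuboctahedral shell) no touching
  pair of neighbours has two common neighbours among the neighbours (`decide`);
* `dist_eq_one_iff_shellAdj`, `mem_shellOffsets_of_dist_eq_one` — the model IS the first coordination
  shell of `barlowPos 1 √(2/3) s k i j` in the ideal stacking of any Hägg word `s`
  (`BarlowCoordination.dist_barlowPos_eq_iff_form` / `dist_barlowPos_eq_iff`);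
* **`isHexSite_chart_iff`** — for a Barlow-like `S` with chart `(s, Φ)` (H4's bond-isomorphism), the
  image of the site `(k, i, j)` is a hexagonal site of `S` iff `s k = -s (k-1)`;
* `eq_alternating_or_neg_of_forall` — a Hägg word with `s k = -s (k-1)` for all `k` is
  `±alternatingHagg`; `barlowPos_neg_alternating` — the stacking of `−alternatingHagg` is the point
  reflection of the hcp stacking, so a chart with that word is an hcp chart after `x ↦ −x`
  (`hcpCharted_of_chart_neg_alternating`);
* **`stub_haggSelection_hexWord`** (registered sub-goal of `stub_haggSelection`): a Barlow-like
  configuration all of whose points are hexagonal sites is hcp-charted (`HcpCharted`).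

No potential, no measure. All `[folklore]`.
-/

noncomputable section

namespace Summit.AtomisticToContinuum.Crystallization.Theorems.PalmUnimodularRigidity.LayeredLawsSelectHcp

open MeasureTheory Set
open Literature.MathematicalPhysics.StatisticalMechanics Literature.Geometry.DiscreteGeometry
open Summit.AtomisticToContinuum.Crystallization.Theorems.LayeredLawsSelectHcp.Negative.DiracLaws
  (BarlowLike)

/-- Euclidean `3`-space. [folklore] -/
local notation "E3" => EuclideanSpace ℝ (Fin 3)

/-! ## The finite shell model decides the site type -/

/-- **Cubic shells have no doubly-braced edge** (the cuboctahedral contact graph: every edge lies in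
exactly one triangle): in the shell model with equal adjacent letters `σ₁ = σ₂ = σ`, a touching pair
`p ~ q` of neighbours has at most one common neighbour among the neighbours. A finite check
(`decide`). [folklore] -/
theorem shellModel_cubic {σ : ℤ} (hσ : σ = 1 ∨ σ = -1) :
    ∀ p ∈ shellOffsets σ σ, ∀ q ∈ shellOffsets σ σ, ShellAdj σ σ p q →
      ∀ t ∈ shellOffsets σ σ, ShellAdj σ σ t p → ShellAdj σ σ t q →
        ∀ b ∈ shellOffsets σ σ, ShellAdj σ σ b p → ShellAdj σ σ b q → t = b := by
  rcases hσ with rfl | rfl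
  · decide +kernel
  · decide +kernel

/-- Offsets of the shell model have layer offset `-1`, `0` or `1`. [folklore] -/
theorem fst_of_mem_shellOffsets {σ₁ σ₂ dk di dj : ℤ} (ho : (dk, di, dj) ∈ shellOffsets σ₁ σ₂) :
    dk = -1 ∨ dk = 0 ∨ dk = 1 := by
  unfold shellOffsets at ho
  split_ifs at ho <;>
    simp only [List.mem_append, List.mem_cons, List.not_mem_nil, or_false, Prod.mk.injEq] at ho <;>
    omega

/-! ## The model is the first coordination shell of the ideal stacking -/

section Ideal

variable {s : ℤ → ℤ}

/-- `(√(2/3))² = ⅔ · 1²`: the unit ideal stacking has the ideal layer spacing (same statement as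
`sqrt_twoThirds_sq` of `…LocalCongruenceFrames`, restated to keep the import closure small). [folklore] -/
theorem ideal_spacing_sq : (Real.sqrt (2 / 3)) ^ 2 = 2 / 3 * (1 : ℝ) ^ 2 := by
  rw [Real.sq_sqrt (by norm_num)]; ring

/-- Layer labels near layer `k` in terms of the two adjacent letters:
`L k₁ = L k + relLabel (s (k-1)) (s k) (k₁ - k)` for `|k₁ - k| ≤ 1`. [folklore] -/
theorem haggLabel_eq_add_relLabel (s : ℤ → ℤ) {k k₁ : ℤ} (h : k₁ - k = -1 ∨ k₁ - k = 0 ∨ k₁ - k = 1) :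
    haggLabel s k₁ = haggLabel s k + relLabel (s (k - 1)) (s k) (k₁ - k) := by
  rcases h with h | h | h
  · obtain rfl : k₁ = k - 1 := by omega
    have := haggLabel_sub_haggLabel_pred s k
    rw [h, relLabel, if_neg (by decide), if_pos rfl]
    linarith
  · obtain rfl : k₁ = k := by omega
    simp [relLabel]
  · obtain rfl : k₁ = k + 1 := by omega
    rw [h, relLabel, if_pos rfl, haggLabel_succ]

/-- **The model's contact relation is touching in the ideal stacking**: two sites of the layers
`k-1, k, k+1` touch (`dist = 1`) iff `ShellAdj` holds between their offsets from `(k, i, j)`.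
[folklore] -/
theorem dist_eq_one_iff_shellAdj (s : ℤ → ℤ) (k i j : ℤ) {k₁ i₁ j₁ k₂ i₂ j₂ : ℤ}
    (h₁ : k₁ - k = -1 ∨ k₁ - k = 0 ∨ k₁ - k = 1) (h₂ : k₂ - k = -1 ∨ k₂ - k = 0 ∨ k₂ - k = 1) :
    dist (barlowPos 1 (Real.sqrt (2 / 3)) s k₁ i₁ j₁) (barlowPos 1 (Real.sqrt (2 / 3)) s k₂ i₂ j₂) = 1 ↔
      ShellAdj (s (k - 1)) (s k) (k₁ - k, i₁ - i, j₁ - j) (k₂ - k, i₂ - i, j₂ - j) := by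
  rw [dist_barlowPos_eq_iff_form one_pos ideal_spacing_sq, haggLabel_eq_add_relLabel s h₁,
    haggLabel_eq_add_relLabel s h₂]
  unfold ShellAdj
  constructor <;> intro h <;> linear_combination h

/-- The shell model is complete: every in-layer / upper / lower neighbour offset of
`BarlowCoordination.dist_barlowPos_eq_iff` is listed (a finite check). [folklore] -/
theorem shellOffsets_complete {σ₁ σ₂ : ℤ} (h₁ : σ₁ = 1 ∨ σ₁ = -1) (h₂ : σ₂ = 1 ∨ σ₂ = -1) :
    (∀ PQ ∈ sixOffsets, ((0 : ℤ), -PQ.1, -PQ.2) ∈ shellOffsets σ₁ σ₂) ∧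
    (∀ PQ ∈ threeOffsets (-σ₂), ((1 : ℤ), -PQ.1, -PQ.2) ∈ shellOffsets σ₁ σ₂) ∧
    (∀ PQ ∈ threeOffsets σ₁, ((-1 : ℤ), -PQ.1, -PQ.2) ∈ shellOffsets σ₁ σ₂) := by
  rcases h₁ with rfl | rfl <;> rcases h₂ with rfl | rfl <;> decide

/-- **The model lists the first coordination shell**: a site at distance `1` from
`barlowPos 1 √(2/3) s k i j` has its offset in `shellOffsets (s (k-1)) (s k)`
(`BarlowCoordination.dist_barlowPos_eq_iff`). [folklore] -/
theorem mem_shellOffsets_of_dist_eq_one (hs : IsHaggSeq s) {k i j k' i' j' : ℤ}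
    (h : dist (barlowPos 1 (Real.sqrt (2 / 3)) s k i j) (barlowPos 1 (Real.sqrt (2 / 3)) s k' i' j') = 1) :
    (k' - k, i' - i, j' - j) ∈ shellOffsets (s (k - 1)) (s k) := by
  obtain ⟨c0, c1, c2⟩ := shellOffsets_complete (hs (k - 1)) (hs k)
  rcases (dist_barlowPos_eq_iff hs one_pos ideal_spacing_sq k i j k' i' j').1 h with
    ⟨rfl, hm⟩ | ⟨rfl, hm⟩ | ⟨rfl, hm⟩
  · simpa [neg_sub] using c0 _ hm
  · simpa [neg_sub] using c1 _ hm
  · simpa [neg_sub] using c2 _ hm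

end Ideal

/-! ## Through a chart: the site type of a Barlow-like configuration is read off the Hägg word -/

section Chart

variable {s : ℤ → ℤ} {S : Set E3} {Φ : E3 → E3}

/-- Under a chart, bonds of `S` between chart images of lattice sites are exactly the touching pairs
of the ideal stacking. [folklore] -/
theorem bond_chart_iff (hbij : Set.BijOn Φ (barlowStacking 1 (Real.sqrt (2 / 3)) s) S)
    (hiso : ∀ p ∈ barlowStacking 1 (Real.sqrt (2 / 3)) s, ∀ q ∈ barlowStacking 1 (Real.sqrt (2 / 3)) s,
      (dist p q = 1 ↔ (0 < dist (Φ p) (Φ q) ∧ dist (Φ p) (Φ q) ≤ 28 / 25)))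
    (k₁ i₁ j₁ k₂ i₂ j₂ : ℤ) :
    Bond S (Φ (barlowPos 1 (Real.sqrt (2 / 3)) s k₁ i₁ j₁)) (Φ (barlowPos 1 (Real.sqrt (2 / 3)) s k₂ i₂ j₂)) ↔
      dist (barlowPos 1 (Real.sqrt (2 / 3)) s k₁ i₁ j₁) (barlowPos 1 (Real.sqrt (2 / 3)) s k₂ i₂ j₂) = 1 := by
  rw [hiso _ (barlowPos_mem _ _ _) _ (barlowPos_mem _ _ _)]
  exact ⟨fun h => h.2.2, fun h => ⟨hbij.mapsTo (barlowPos_mem _ _ _), hbij.mapsTo (barlowPos_mem _ _ _), h⟩⟩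

/-- **The site type is the local Hägg pattern.** For a Barlow-like `S` with chart `(s, Φ)`, the image
of the lattice site `(k, i, j)` is a HEXAGONAL site of `S` iff the two letters adjacent to layer `k`
differ, `s k = -s (k-1)` (anticuboctahedral shell: the upper and lower neighbour triples cover the same
hollows, so an in-layer shell edge is braced from above AND below); otherwise (`s k = s (k-1)`,
cuboctahedral shell) no shell edge is doubly braced (`shellModel_cubic`). [folklore] -/
theorem isHexSite_chart_iff (hs : IsHaggSeq s)
    (hbij : Set.BijOn Φ (barlowStacking 1 (Real.sqrt (2 / 3)) s) S)
    (hiso : ∀ p ∈ barlowStacking 1 (Real.sqrt (2 / 3)) s, ∀ q ∈ barlowStacking 1 (Real.sqrt (2 / 3)) s,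
      (dist p q = 1 ↔ (0 < dist (Φ p) (Φ q) ∧ dist (Φ p) (Φ q) ≤ 28 / 25)))
    (k i j : ℤ) :
    IsHexSite S (Φ (barlowPos 1 (Real.sqrt (2 / 3)) s k i j)) ↔ s k = -s (k - 1) := by
  constructor
  · rintro ⟨p, q, t, b, htb, hxp, hxq, hxt, hxb, hpq, htp, htq, hbp, hbq⟩
    by_contra hne
    have hsk : s k = s (k - 1) := by
      rcases hs k with h | h <;> rcases hs (k - 1) with h' | h' <;> omega
    -- pull the four witnesses back to lattice sites
    obtain ⟨p, hpB, rfl⟩ := hbij.surjOn hxp.2.1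
    obtain ⟨q, hqB, rfl⟩ := hbij.surjOn hxq.2.1
    obtain ⟨t, htB, rfl⟩ := hbij.surjOn hxt.2.1
    obtain ⟨b, hbB, rfl⟩ := hbij.surjOn hxb.2.1
    obtain ⟨kp, ip, jp, rfl⟩ := hpB
    obtain ⟨kq, iq, jq, rfl⟩ := hqB
    obtain ⟨kt, it, jt, rfl⟩ := htB
    obtain ⟨kb, ib, jb, rfl⟩ := hbB
    simp only [bond_chart_iff hbij hiso] at hxp hxq hxt hxb hpq htp htq hbp hbq
    -- read them in the shell model of the site `(k, i, j)`
    have mp := mem_shellOffsets_of_dist_eq_one hs hxp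
    have mq := mem_shellOffsets_of_dist_eq_one hs hxq
    have mt := mem_shellOffsets_of_dist_eq_one hs hxt
    have mb := mem_shellOffsets_of_dist_eq_one hs hxb
    rw [dist_eq_one_iff_shellAdj s k i j (fst_of_mem_shellOffsets mp) (fst_of_mem_shellOffsets mq)]
      at hpq
    rw [dist_eq_one_iff_shellAdj s k i j (fst_of_mem_shellOffsets mt) (fst_of_mem_shellOffsets mp)]
      at htp
    rw [dist_eq_one_iff_shellAdj s k i j (fst_of_mem_shellOffsets mt) (fst_of_mem_shellOffsets mq)]
      at htq
    rw [dist_eq_one_iff_shellAdj s k i j (fst_of_mem_shellOffsets mb) (fst_of_mem_shellOffsets mp)]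
      at hbp
    rw [dist_eq_one_iff_shellAdj s k i j (fst_of_mem_shellOffsets mb) (fst_of_mem_shellOffsets mq)]
      at hbq
    rw [hsk] at mp mq mt mb hpq htp htq hbp hbq
    -- the cubic shell model has no doubly-braced edge
    have key := shellModel_cubic (hs (k - 1)) _ mp _ mq hpq _ mt htp htq _ mb hbp hbq
    simp only [Prod.mk.injEq] at key
    obtain ⟨e1, e2, e3⟩ := key
    exact htb (by rw [show kt = kb by omega, show it = ib by omega, show jt = jb by omega])
  · intro hk
    obtain ⟨σ, hσ, h1, h2⟩ : ∃ σ : ℤ, (σ = 1 ∨ σ = -1) ∧ s (k - 1) = σ ∧ s k = -σ :=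
      ⟨s (k - 1), hs (k - 1), rfl, hk⟩
    have hx : barlowPos 1 (Real.sqrt (2 / 3)) s k i j =
        barlowPos 1 (Real.sqrt (2 / 3)) s (k + 0) (i + 0) (j + 0) := by simp only [add_zero]
    rw [hx]
    -- bonds from the shell model
    have D : ∀ {dk₁ di₁ dj₁ dk₂ di₂ dj₂ : ℤ}, (dk₁ = -1 ∨ dk₁ = 0 ∨ dk₁ = 1) →
        (dk₂ = -1 ∨ dk₂ = 0 ∨ dk₂ = 1) → ShellAdj σ (-σ) (dk₁, di₁, dj₁) (dk₂, di₂, dj₂) →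
        Bond S (Φ (barlowPos 1 (Real.sqrt (2 / 3)) s (k + dk₁) (i + di₁) (j + dj₁)))
          (Φ (barlowPos 1 (Real.sqrt (2 / 3)) s (k + dk₂) (i + di₂) (j + dj₂))) := by
      intro dk₁ di₁ dj₁ dk₂ di₂ dj₂ e₁ e₂ hadj
      rw [bond_chart_iff hbij hiso,
        dist_eq_one_iff_shellAdj s k i j (k₁ := k + dk₁) (k₂ := k + dk₂) (by simpa using e₁)
          (by simpa using e₂)]
      simpa [h1, h2] using hadj
    refine ⟨Φ (barlowPos 1 (Real.sqrt (2 / 3)) s (k + 0) (i + -σ) (j + 0)),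
      Φ (barlowPos 1 (Real.sqrt (2 / 3)) s (k + 0) (i + 0) (j + -σ)),
      Φ (barlowPos 1 (Real.sqrt (2 / 3)) s (k + 1) (i + 0) (j + 0)),
      Φ (barlowPos 1 (Real.sqrt (2 / 3)) s (k + -1) (i + 0) (j + 0)), ?_,
      D (by omega) (by omega) (by rcases hσ with rfl | rfl <;> decide),
      D (by omega) (by omega) (by rcases hσ with rfl | rfl <;> decide),
      D (by omega) (by omega) (by rcases hσ with rfl | rfl <;> decide),
      D (by omega) (by omega) (by rcases hσ with rfl | rfl <;> decide),
      D (by omega) (by omega) (by rcases hσ with rfl | rfl <;> decide),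
      D (by omega) (by omega) (by rcases hσ with rfl | rfl <;> decide),
      D (by omega) (by omega) (by rcases hσ with rfl | rfl <;> decide),
      D (by omega) (by omega) (by rcases hσ with rfl | rfl <;> decide),
      D (by omega) (by omega) (by rcases hσ with rfl | rfl <;> decide)⟩
    -- the upper and lower apex differ (different layers)
    intro heq
    have h3 := congrArg (fun v : E3 => v 2)
      (hbij.injOn (barlowPos_mem _ _ _) (barlowPos_mem _ _ _) heq)
    simp only [barlowPos_apply_two] at h3
    have hH : (0 : ℝ) < Real.sqrt (2 / 3) := Real.sqrt_pos.2 (by norm_num)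
    have h4 : ((k + 1 : ℤ) : ℝ) = ((k + -1 : ℤ) : ℝ) := mul_right_cancel₀ hH.ne' h3
    have h5 : (k + 1 : ℤ) = k + -1 := by exact_mod_cast h4
    omega

end Chart



/-! ## Words all of whose sites are hexagonal: `±alternatingHagg`, and the point reflection -/

section Word

/-- `alternatingHagg (m + 1) = -alternatingHagg m`. [folklore] -/
theorem alternatingHagg_add_one (m : ℤ) : alternatingHagg (m + 1) = -alternatingHagg m := by
  by_cases hm : Even m
  · simp [alternatingHagg, hm, parity_simps]
  · simp [alternatingHagg, hm, parity_simps]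

/-- `alternatingHagg (m - 1) = -alternatingHagg m`. [folklore] -/
theorem alternatingHagg_sub_one (m : ℤ) : alternatingHagg (m - 1) = -alternatingHagg m := by
  by_cases hm : Even m
  · simp [alternatingHagg, hm, parity_simps]
  · simp [alternatingHagg, hm, parity_simps]

/-- **A Hägg word with no two equal consecutive letters is `±` the alternating (hcp) word.**
[folklore] -/
theorem eq_alternating_or_neg_of_forall {s : ℤ → ℤ} (hs : IsHaggSeq s) (h : ∀ k, s k = -s (k - 1)) :
    (∀ m, s m = alternatingHagg m) ∨ (∀ m, s m = -alternatingHagg m) := by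
  have key : ∀ m, s m = s 0 * alternatingHagg m := by
    intro m
    induction m using Int.induction_on with
    | zero => simp [alternatingHagg]
    | succ n ih =>
      rw [h ((n : ℤ) + 1), add_sub_cancel_right, ih, alternatingHagg_add_one]
      ring
    | pred n ih =>
      have e : s (-(n : ℤ) - 1) = -s (-(n : ℤ)) := by rw [h (-(n : ℤ)), neg_neg]
      rw [e, ih, alternatingHagg_sub_one]
      ring
  rcases hs 0 with h0 | h0
  · exact Or.inl fun m => by rw [key m, h0, one_mul]
  · exact Or.inr fun m => by rw [key m, h0, neg_one_mul]

/-- Labels of the negated word are the negated labels. [folklore] -/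
theorem haggLabel_neg (s : ℤ → ℤ) (k : ℤ) : haggLabel (fun m => -s m) k = -haggLabel s k := by
  unfold haggLabel haggWindow
  split_ifs <;> simp [Finset.sum_neg_distrib]

/-- **The stacking of the word `−alternatingHagg` is the point reflection of the hcp stacking**:
`barlowPos (−alt) k i j = −barlowPos alt (−k) (−i) (−j)` (the hcp labels `[k odd]` are even in `k`).
[folklore] -/
theorem barlowPos_neg_alternating (a h : ℝ) (k i j : ℤ) :
    barlowPos a h (fun m => -alternatingHagg m) k i j = -barlowPos a h alternatingHagg (-k) (-i) (-j) := by
  have hL : (haggLabel (fun m => -alternatingHagg m) k : ℝ) = -haggLabel alternatingHagg (-k) := by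
    rw [haggLabel_neg, haggLabel_alternating, haggLabel_alternating]
    simp only [even_neg]
    push_cast
    rfl
  ext l
  fin_cases l
  · simp only [Fin.zero_eta, Fin.isValue, barlowPos_apply_zero, PiLp.neg_apply, hL]
    push_cast; ring
  · simp only [Fin.mk_one, Fin.isValue, barlowPos_apply_one, PiLp.neg_apply, hL]
    push_cast; ring
  · simp only [Fin.reduceFinMk, Fin.isValue, barlowPos_apply_two, PiLp.neg_apply]
    push_cast; ring

/-- The point reflection is a bijection from the hcp stacking onto the stacking of `−alternatingHagg`.
[folklore] -/
theorem bijOn_neg_hcpStacking (a h : ℝ) :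
    Set.BijOn (fun x : E3 => -x) (barlowStacking a h alternatingHagg)
      (barlowStacking a h (fun m => -alternatingHagg m)) := by
  refine ⟨?_, neg_injective.injOn, ?_⟩
  · rintro _ ⟨k, i, j, rfl⟩
    refine ⟨-k, -i, -j, ?_⟩
    rw [barlowPos_neg_alternating, neg_neg, neg_neg, neg_neg]
  · rintro _ ⟨k, i, j, rfl⟩
    exact ⟨barlowPos a h alternatingHagg (-k) (-i) (-j), barlowPos_mem _ _ _,
      (barlowPos_neg_alternating a h k i j).symm⟩

/-- A chart with the word `−alternatingHagg` is an hcp chart after the point reflection. [folklore] -/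
theorem hcpCharted_of_chart_neg_alternating {S : Set E3} {Φ : E3 → E3}
    (hbij : Set.BijOn Φ (barlowStacking 1 (Real.sqrt (2 / 3)) (fun m => -alternatingHagg m)) S)
    (hiso : ∀ p ∈ barlowStacking 1 (Real.sqrt (2 / 3)) (fun m => -alternatingHagg m),
      ∀ q ∈ barlowStacking 1 (Real.sqrt (2 / 3)) (fun m => -alternatingHagg m),
        (dist p q = 1 ↔ (0 < dist (Φ p) (Φ q) ∧ dist (Φ p) (Φ q) ≤ 28 / 25))) :
    HcpCharted S := by
  have hB := bijOn_neg_hcpStacking 1 (Real.sqrt (2 / 3))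
  refine ⟨fun x => Φ (-x), hbij.comp hB, fun p hp q hq => ?_⟩
  rw [← hiso (-p) (hB.mapsTo hp) (-q) (hB.mapsTo hq), dist_neg_neg]

/-- **Registered sub-goal `stub_haggSelection_hexWord` of `stub_haggSelection` (the word
combinatorics of the selection half): a Barlow-like configuration all of whose points are hexagonal
sites is hcp-charted.** With a chart `(s, Φ)`, the image of `barlowPos s k 0 0` is hexagonal for every
`k`, so `s k = -s (k-1)` for all `k` (`isHexSite_chart_iff`), hence `s = ±alternatingHagg`
(`eq_alternating_or_neg_of_forall`); the `−` sign is absorbed by the point reflection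
(`hcpCharted_of_chart_neg_alternating`). [folklore] -/
theorem stub_haggSelection_hexWord :
    ∀ S : Set E3, BarlowLike S → (∀ x ∈ S, IsHexSite S x) → HcpCharted S := by
  rintro S ⟨s, hs, Φ, hbij, hiso⟩ hhex
  have hk : ∀ k, s k = -s (k - 1) := fun k =>
    (isHexSite_chart_iff hs hbij hiso k 0 0).1 (hhex _ (hbij.mapsTo (barlowPos_mem k 0 0)))
  rcases eq_alternating_or_neg_of_forall hs hk with h | h
  · obtain rfl : s = alternatingHagg := funext h
    exact ⟨Φ, hbij, hiso⟩
  · obtain rfl : s = fun m => -alternatingHagg m := funext h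
    exact hcpCharted_of_chart_neg_alternating hbij hiso

end Word

end Summit.AtomisticToContinuum.Crystallization.Theorems.PalmUnimodularRigidity.LayeredLawsSelectHcp

end
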